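import Mathlib
import Summits.Schanuel.Schanuel.Theses.RigidCore

/-!
# Sketch — crux-ideate stmt-Schanuel-0971 (SparsityTwo), ideator 3

First lemmas of the line `function-field-heights-finite-type` (card Ideas/function-field-heights-finite-type.md),
stated over existing declarations only (Mathlib + `Summit.Schanuel.Schanuel.Theses.RigidCore.SparsityTwo`
+ `Literature.NumberTheory.Transcendental.IsDefinedOver/zariskiDim`). Nothing here is proved except the
bookkeeping transfer `SparsityTwoFiniteType ∧ RankBound → SparsityTwo`.
-/

noncomputable section

open Complex

namespace Summit.Schanuel.Schanuel.Cruxes.SparsityTwo.FunctionFieldHeights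

/-- MODEL THEOREM (first lemma; proved on paper in the card): exact torsion chain `y₁ = 1`
(so `x₁ = 2πij`), monomial twist `x₂ = x₁ ^ d` with `d ≥ 2`, arbitrary third equation
`F(x₁, y₂) = 0` over `ℚ`: only finitely many sheets `j`. Unitary (`d` odd) and non-unitary
(`d` even) cases uniformly; inputs: `π ∉ ℚ̄` + degree calculus in `ℚ̄(π)^alg`. -/
def ExactChainMonomialTwistFinite : Prop :=
  ∀ (d : ℕ), 2 ≤ d → ∀ (F : MvPolynomial (Fin 2) ℚ), F ≠ 0 →
    Set.Finite {j : ℤ | MvPolynomial.aeval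
      ![2 * ↑Real.pi * Complex.I * (j : ℂ),
        Complex.exp ((2 * ↑Real.pi * Complex.I * (j : ℂ)) ^ d)] F = 0}

/-- Same with a polynomial twist `ψ ∈ ℚ̄[X]`, `deg ψ ≥ 2`, and `F` over `ℚ̄`
(peeling argument: seminorm continuity on the moment curve `(1,k,…,k^D)`). -/
def ExactChainPolynomialTwistFinite : Prop :=
  ∀ (ψ : Polynomial ↥(algebraicClosure ℚ ℂ)), 2 ≤ ψ.natDegree →
    ∀ (F : MvPolynomial (Fin 2) ↥(algebraicClosure ℚ ℂ)), F ≠ 0 →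
      Set.Finite {j : ℤ | MvPolynomial.aeval
        ![2 * ↑Real.pi * Complex.I * (j : ℂ),
          Complex.exp (Polynomial.aeval (2 * ↑Real.pi * Complex.I * (j : ℂ)) ψ)] F = 0}

/-- The `W`-form of the model theorem: the ℚ-curve `W_{d,F} = {y₁ = 1, x₂ = x₁^d, F(x₁,y₂) = 0}`
inside `ℂ² × ℂ²` (coordinates `Sum.inl` = additive, `Sum.inr` = multiplicative). -/
def twistCurve (d : ℕ) (F : MvPolynomial (Fin 2) ℚ) : Set (Fin 2 ⊕ Fin 2 → ℂ) :=
  {z | z (Sum.inr 0) = 1 ∧ z (Sum.inl 1) = z (Sum.inl 0) ^ d ∧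
       MvPolynomial.aeval ![z (Sum.inl 0), z (Sum.inr 1)] F = 0}

/-- `SparsityTwo` restricted to the twist curves (an instance family of the crux, all previously
open when `d` is odd and `F` is unitary-symmetric, e.g. `F = (1 - X) Y - (1 + X)`). -/
def TwistCurveSparsity : Prop :=
  ∀ (d : ℕ), 2 ≤ d → ∀ (F : MvPolynomial (Fin 2) ℚ), F ≠ 0 →
    Set.Finite {x : Fin 2 → ℂ | LinearIndependent ℚ x ∧ Sum.elim x (Complex.exp ∘ x) ∈ twistCurve d F}

/-- FINITE-TYPE SparsityTwo (the target C⁺ of the line): independent graph points on a ℚ-curve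
whose abscissae lie in a fixed finite-dimensional ℚ-subspace `V ⊂ ℂ` are finitely many. -/
def SparsityTwoFiniteType : Prop :=
  ∀ (W : Set (Fin 2 ⊕ Fin 2 → ℂ)),
    Literature.NumberTheory.Transcendental.IsDefinedOver (⊥ : Subfield ℂ) W →
    Literature.NumberTheory.Transcendental.zariskiDim ℂ W < 2 →
    ∀ (V : Submodule ℚ ℂ), FiniteDimensional ℚ V →
      Set.Finite {x : Fin 2 → ℂ | LinearIndependent ℚ x ∧ (∀ i, x i ∈ V) ∧
        Sum.elim x (Complex.exp ∘ x) ∈ W}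

/-- `RankBound`: the residual of the crux after the line — the abscissae of independent graph
points on a ℚ-curve span a finite-dimensional ℚ-space (vacuous under SC(2); open exactly on
two-inexact-chain (Shapiro) curves and on exact chains with non-Laurent twists). -/
def RankBound : Prop :=
  ∀ (W : Set (Fin 2 ⊕ Fin 2 → ℂ)),
    Literature.NumberTheory.Transcendental.IsDefinedOver (⊥ : Subfield ℂ) W →
    Literature.NumberTheory.Transcendental.zariskiDim ℂ W < 2 →
    ∃ (V : Submodule ℚ ℂ), FiniteDimensional ℚ V ∧
      ∀ x : Fin 2 → ℂ, LinearIndependent ℚ x → Sum.elim x (Complex.exp ∘ x) ∈ W → ∀ i, x i ∈ V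

/-- Transfer (bookkeeping, kernel-checked): `SparsityTwoFiniteType ∧ RankBound → SparsityTwo`. -/
theorem sparsityTwo_of_finiteType_of_rankBound
    (h1 : SparsityTwoFiniteType) (h2 : RankBound) :
    Summit.Schanuel.Schanuel.Theses.RigidCore.SparsityTwo := by
  intro W hW hdim
  obtain ⟨V, hV, hmem⟩ := h2 W hW hdim
  refine (h1 W hW hdim V hV).subset ?_
  intro x hx
  exact ⟨hx.1, hmem x hx.1 hx.2, hx.2⟩

end Summit.Schanuel.Schanuel.Cruxes.SparsityTwo.FunctionFieldHeights

end
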